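import Summits.ResolutionOfSingularities.ResolutionOfSingularities.Theorems.HilbertSamuelEliminationSigmaMaxModificationsCorridor3SigmaStepDefs
import Summits.ResolutionOfSingularities.ResolutionOfSingularities.Theorems.HilbertSamuelEliminationSigmaMaxModificationsCorridor3WLadderIsoTransitionBirth
import HarnessLib

/-!
# [OURS · L1 W4.2] σ-LAYER — `Corridor3SigmaIsoDefs`: the ISOLATION rows (Ev-Iso / Rec-Iso / Rec-NonIso / ALT), the isolated-tail
# extraction row and the two D17 laws, PARAMETRISED BY A STRATEGY `σ` (W4.2 DEAL D16-σ «ISOLATED ROWS ARE STRATEGY-FREE»,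
# res-L1-w42-plan-1 RULINGS v3.14-11a (CP) 2026-08-27T10:08:46Z → res-type-012; crux chain w42 `SigmaMaxModificationsCorridor3`
# stmt-ResolutionOfSingularities-19249 / crux stmt-…-18506; `--supports stmt-ResolutionOfSingularities-19249 --as helper`, counted 0)

HONEST FRAMING. OURS bookkeeping vocabulary over res-D-pv-047's σ-layer part 1 (`…Corridor3SigmaStepDefs`: `Strategy`, `Strategy.cjs`,
`CanonicalNearStepσ`, `Reachesσ`, `MarkedStage.IsBlownUpσ`, `NoMovingNearChainFromσ`, `MaxOriginNoMovingNearChainAtQσ`, `WtopEvNonIsoMσ`);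
NOTHING here is a statement of H. Hironaka's manuscript [Hironaka2017] nor of Cossart–Jannsen–Saito; nothing is asserted beyond
definitional unfoldings (`Iff.rfl` transports to the landed CJS-oracle rows at `σ := Strategy.cjs R`). No row of res-type-040 /
res-D-pv-047 / res-type-067 / res-L1-type-o1 is touched or restated: every definition below is the σ-COPY — VERBATIM except that
`IsCanonicalStep R N ν s.L s.P C P'` becomes `σ.step s.W s.ln N ν s.L s.P C P'` and the oracle binder
`∀ R, OracleFunctional R → OracleAdmissible R →` is REPLACED by the strategy parameter (047's convention (D1): `ν` stays quantified
INSIDE the rows, so the transports are literally `Iff.rfl`) — of a landed R-row: res-type-053's `NoMovingRecurrentNearChainFrom` /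
`MaxOriginNoMovingRecurrentNearChainAtQ` (`…Corridor3WLadderMovingDefs`, p496136), res-type-012's r4 rows `WtopEvIsoM` / `WtopRecIsoM` /
`WtopRecNonIsoM` / `IsoTailTowerExtractionM` (`…MovingIsoDefs`, p500943) and D16 rows `NoMovingAlternatingNearChainFrom` /
`MaxOriginNoMovingAlternatingNearChainAtQ` / `WtopAltM` (`…MovingAltDefs`, p517919), res-type-053's `StepProjection`
(`…StrataLineages`), res-type-067's `NoRecurrentIsoPointBirth3` (`…IsoTransitionBirthDefs`, p517090) and `IsoTransitionLaw3`
(`…IsoTransitionBirth`, p518912). AI-written; AI review is weaker than expert review.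

WHY (plan of record, RULINGS v3.14-11a (CP)): the v7/v8.2 POINTED closers (`wtopRecIsoM_pointed_of_kernel`, p521299;
`wtop3PointedM_of_floor`, p520512) are stated for the CJS label strategy; the hybrid `ω_ρ`-run of `stub_Wtop_elimination` is ANOTHER
strategy `σ`, and consumes the pointed closers at its pointed stages. THE POINT (typed in `…Corridor3SigmaIsoExtraction`): at an ISOLATED
point `x` of `X(ν)` the only `ν`-permissible centre inside `X(ν)` through `x` is `{x}` near `x`, so EVERY admissible functional σ blows `x`
up by the point and the quadratic tower above `x` is σ-independent — the isolated KERNEL `IsoQuadraticTowerTerminates p 3` is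
strategy-free. ANSWER to (CP)'s «if the birth law is σ-sensitive say so»: YES — `NoRecurrentIsoPointBirth3 p Q` and
`IsoTransitionLaw3 p Q` quantify over CJS chains only; their σ-forms `NoRecurrentIsoPointBirth3σ σ p Q`, `IsoTransitionLaw3σ σ p Q` below
are the binders of the σ-closer (at `σ := Strategy.cjs R` they ARE the landed rows, `…_iff_forall_cjs`).

## Contents (namespace `…Theorems.SigmaMaxModificationsCorridor3.Sigma`, res-D-pv-047's)

* §1 functionals: `NoMovingRecurrentNearChainFromσ σ N ν s₀ G B`, `NoMovingAlternatingNearChainFromσ σ N ν s₀ G B`.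
* §2 origin rows: `MaxOriginNoMovingRecurrentNearChainAtQσ σ p N Q G B`, `MaxOriginNoMovingAlternatingNearChainAtQσ σ p N Q G B`; the
  2 × 2 of the core + ALT at level `3`, grade `ē ≥ 3`: `WtopEvIsoMσ`, `WtopRecNonIsoMσ`, `WtopRecIsoMσ`, `WtopAltMσ`
  (`WtopEvNonIsoMσ` is 047's, p519751).
* §3 the extraction row `IsoTailTowerExtractionMσ σ p` (σ-copy of D7's `IsoTailTowerExtractionM p`; PROVED for admissible functional σ in
  `…Corridor3SigmaIsoExtraction`).
* §4 the D17 laws in σ-form: `StepProjectionσ`, `IsoTransitionLaw3σ σ p Q`, `NoRecurrentIsoPointBirth3σ σ p Q`.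
* §5 TRANSPORT at `σ := Strategy.cjs R`, all `Iff.rfl`.

## References (context only)

* V. Cossart, U. Jannsen, S. Saito, LNM 2270 (2020), Rem. 6.29 (1), Def. 6.34, Def. 6.38, Thm. 6.35, Thm. 6.40. [CossartJannsenSaito2020]
-/

noncomputable section

set_option linter.dupNamespace false -- mandated namespace of this single-conjunct summit

open CategoryTheory AlgebraicGeometry TopologicalSpace
open Summit.ResolutionOfSingularities.ResolutionOfSingularities.Theorems.CampaignW42
open Literature.AlgebraicGeometry.Resolution Literature.RingTheory.HilbertSamuel
open Literature.AlgebraicGeometry.CossartJannsenSaito2020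
open Summit.ResolutionOfSingularities.ResolutionOfSingularities.Theorems.SigmaMaxModificationsCorridor3.Moving
open Summit.ResolutionOfSingularities.ResolutionOfSingularities.Cruxes.SigmaMaxModifications.IdeasL1Idea2R4

namespace Summit.ResolutionOfSingularities.ResolutionOfSingularities.Theorems.SigmaMaxModificationsCorridor3.Sigma

universe u

/-! ## §1. The recurrent and the alternating moving functionals, for the strategy `σ` -/

/-- [OURS · L1 W4.2] «No MOVING σ-near `G`-chain from `s₀` visiting `B` infinitely often» — σ-copy of res-type-053's
`NoMovingRecurrentNearChainFrom R N ν s₀ G B` (p496136): no infinite chain of σ-steps followed at marked points, reached from `s₀`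
along σ, inside the grade `G`, whose marked point is blown up (σ-sense, `IsBlownUpσ`) infinitely often AND which satisfies `B`
infinitely often. NOT a statement of the manuscript. [folklore] -/
def NoMovingRecurrentNearChainFromσ (σ : Strategy.{u}) (N : ℕ) (ν : ℕ → ℕ) (s₀ : MarkedStage.{u})
    (G B : MarkedStage.{u} → Prop) : Prop :=
  ¬ ∃ c : ℕ → MarkedStage.{u}, Reachesσ σ N ν s₀ (c 0) ∧ (∀ n, CanonicalNearStepσ σ N ν (c n) (c (n + 1))) ∧
      (∀ n, G (c n)) ∧ (∀ n, ∃ m, n ≤ m ∧ (c m).IsBlownUpσ σ N ν) ∧ ∀ n, ∃ m, n ≤ m ∧ B (c m)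

/-- [OURS · L1 W4.2] «No MOVING σ-near `G`-chain from `s₀` that visits `B` infinitely often AND leaves `B` infinitely often»
(ALTERNATING) — σ-copy of res-type-012's `NoMovingAlternatingNearChainFrom R N ν s₀ G B` (D16, p517919). NOT a statement of the
manuscript. [folklore] -/
def NoMovingAlternatingNearChainFromσ (σ : Strategy.{u}) (N : ℕ) (ν : ℕ → ℕ) (s₀ : MarkedStage.{u})
    (G B : MarkedStage.{u} → Prop) : Prop :=
  ¬ ∃ c : ℕ → MarkedStage.{u}, Reachesσ σ N ν s₀ (c 0) ∧ (∀ n, CanonicalNearStepσ σ N ν (c n) (c (n + 1))) ∧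
      (∀ n, G (c n)) ∧ (∀ n, ∃ m, n ≤ m ∧ (c m).IsBlownUpσ σ N ν) ∧
      (∀ n, ∃ m, n ≤ m ∧ B (c m)) ∧ ∀ n, ∃ m, n ≤ m ∧ ¬ B (c m)

/-! ## §2. The origin rows for `σ`: recurrent / alternating, and the isolation rows at level `3`, grade `ē ≥ 3` -/

/-- [OURS · L1 W4.2] **The moving-RECURRENT row at `Q`-origins, for the strategy `σ`** — σ-copy of
`MaxOriginNoMovingRecurrentNearChainAtQ p N Q G B` (p496136) with the oracle binder `∀ R, OracleFunctional R → OracleAdmissible R →`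
REPLACED by the strategy parameter (`ν` kept inside, 047's convention (D1)): for every value `ν`, every MAXIMAL origin `(X, x)` of
characteristic `p` at level `N` with `Q N ν X x`, no moving σ-chain within `G` from `(X, x)` satisfies `B` infinitely often.
NOT a statement of the manuscript. [folklore] -/
def MaxOriginNoMovingRecurrentNearChainAtQσ (σ : Strategy.{u}) (p N : ℕ)
    (Q : ℕ → (ℕ → ℕ) → ∀ X : Scheme.{u}, X → Prop) (G B : MarkedStage.{u} → Prop) : Prop :=
  ∀ (ν : ℕ → ℕ) (X : Scheme.{u}) [IsLocallyNoetherian X] (x : X), IsMaximalOrigin p N ν X x → Q N ν X x →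
    NoMovingRecurrentNearChainFromσ σ N ν (MarkedStage.init X x) G B

/-- [OURS · L1 W4.2] **The moving-ALTERNATING row at `Q`-origins, for the strategy `σ`** — σ-copy of res-type-012's
`MaxOriginNoMovingAlternatingNearChainAtQ p N Q G B` (D16, p517919). NOT a statement of the manuscript. [folklore] -/
def MaxOriginNoMovingAlternatingNearChainAtQσ (σ : Strategy.{u}) (p N : ℕ)
    (Q : ℕ → (ℕ → ℕ) → ∀ X : Scheme.{u}, X → Prop) (G B : MarkedStage.{u} → Prop) : Prop :=
  ∀ (ν : ℕ → ℕ) (X : Scheme.{u}) [IsLocallyNoetherian X] (x : X), IsMaximalOrigin p N ν X x → Q N ν X x →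
    NoMovingAlternatingNearChainFromσ σ N ν (MarkedStage.init X x) G B

/-- [OURS · L1 W4.2] **Ev-Iso FOR THE STRATEGY `σ`** — σ-copy of the r4 row `WtopEvIsoM p Q` (p500943): no moving σ-chain of grade
`ē ≥ 3`, from a stage σ-reachable from a `Q`-maximal origin of characteristic `p` at level `3`, ALL of whose stages are isolated in the
Hilbert–Samuel locus. For admissible functional σ it follows from the strategy-free kernel `IsoQuadraticTowerTerminates p 3`
(`Sigma.wtopEvIsoMσ_of_towers` ∘ `Sigma.isoTailTowerExtractionMσ_of_admissible`). NOT a statement of the manuscript.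
[cite: CossartJannsenSaito2020, Def. 6.38, Thm. 6.40 (pointers)] -/
def WtopEvIsoMσ (σ : Strategy.{u}) (p : ℕ) (Q : ℕ → (ℕ → ℕ) → ∀ X : Scheme.{u}, X → Prop) : Prop :=
  MaxOriginNoMovingNearChainAtQσ σ p 3 Q fun s => 3 ≤ s.geomDirDim ∧ Iso 3 s

/-- [OURS · L1 W4.2] **Rec-NonIso FOR THE STRATEGY `σ`** — σ-copy of the r4 row `WtopRecNonIsoM p Q` (p500943): no moving σ-chain of
grade `ē ≥ 3` from a `Q`-maximal origin that is NON-isolated infinitely often. NOT a statement of the manuscript.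
[cite: CossartJannsenSaito2020, Thm. 6.35, Rem. 6.29 (pointers)] -/
def WtopRecNonIsoMσ (σ : Strategy.{u}) (p : ℕ) (Q : ℕ → (ℕ → ℕ) → ∀ X : Scheme.{u}, X → Prop) : Prop :=
  MaxOriginNoMovingRecurrentNearChainAtQσ σ p 3 Q (fun s => 3 ≤ s.geomDirDim) fun s => ¬ Iso 3 s

/-- [OURS · L1 W4.2] **Rec-Iso FOR THE STRATEGY `σ`** — σ-copy of the r4 row `WtopRecIsoM p Q` (p500943; at `Q = QPointed` and
`σ := Strategy.cjs R` the v8.2 registered pointed stub `stub_WtopRecIsoM_pointed`): no moving σ-chain of grade `ē ≥ 3` from a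
`Q`-maximal origin that is ISOLATED in the Hilbert–Samuel locus infinitely often. Its pointed σ-closer is
`Sigma.wtopRecIsoMσ_pointed_of_kernel` / `…_of_admissible`. NOT a statement of the manuscript.
[cite: CossartJannsenSaito2020, Def. 6.39, Thm. 6.40 (pointers)] -/
def WtopRecIsoMσ (σ : Strategy.{u}) (p : ℕ) (Q : ℕ → (ℕ → ℕ) → ∀ X : Scheme.{u}, X → Prop) : Prop :=
  MaxOriginNoMovingRecurrentNearChainAtQσ σ p 3 Q (fun s => 3 ≤ s.geomDirDim) fun s => Iso 3 s

/-- [OURS · L1 W4.2] **ALT FOR THE STRATEGY `σ`** — σ-copy of the D16 row `WtopAltM p Q` (p517919): no moving σ-chain of grade `ē ≥ 3`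
from a `Q`-maximal origin that is isolated in the Hilbert–Samuel locus infinitely often AND non-isolated infinitely often. OPEN content
as for the CJS row: it follows from the σ-transition law and the σ-birth law (`Sigma.wtopAltMσ_of_noRecurrentIsoPointBirth3σ`).
NOT a statement of the manuscript. [cite: CossartJannsenSaito2020, Thm. 6.35, Thm. 6.40, Rem. 6.29 (pointers)] -/
def WtopAltMσ (σ : Strategy.{u}) (p : ℕ) (Q : ℕ → (ℕ → ℕ) → ∀ X : Scheme.{u}, X → Prop) : Prop :=
  MaxOriginNoMovingAlternatingNearChainAtQσ σ p 3 Q (fun s => 3 ≤ s.geomDirDim) fun s => Iso 3 s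

/-! ## §3. The isolated-tail tower extraction row, for the strategy `σ` -/

/-- [OURS · L1 W4.2] **Isolated-tail tower extraction FOR THE STRATEGY `σ`** — σ-copy of D7's row `IsoTailTowerExtractionM p`
(p500943; proved for CJS by res-D-pv-042, `isoTailTowerExtractionM_holds`, `…IsoTailExtraction`): a MOVING σ-chain from a stage
σ-reachable from a maximal origin of characteristic `p` at level `3`, all of whose stages are ISOLATED `ē ≥ 3` stages, yields an
isolated E3 point tower (`IsIsoPointTower`, oracle/strategy/label-free) over a maximal origin. PROVED for every ADMISSIBLE FUNCTIONAL σ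
(`Sigma.isoTailTowerExtractionMσ_of_admissible`): at an isolated stage an allowed centre through the marked point is permissible and
inside `X_n(ν) ⊆ (X_n)_max`, hence is the point near the point — THE strategy-freeness of the isolated kernel. NOT a statement of the
manuscript. [cite: CossartJannsenSaito2020, Def. 6.34, Def. 6.38, Rem. 6.29 (1) (pointers)] -/
def IsoTailTowerExtractionMσ (σ : Strategy.{u}) (p : ℕ) : Prop :=
  ∀ (ν : ℕ → ℕ) (X : Scheme.{u}) [IsLocallyNoetherian X] (x : X), IsMaximalOrigin p 3 ν X x →
  ∀ c : ℕ → MarkedStage.{u}, Reachesσ σ 3 ν (MarkedStage.init X x) (c 0) →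
    (∀ n, CanonicalNearStepσ σ 3 ν (c n) (c (n + 1))) → (∀ n, 3 ≤ (c n).geomDirDim ∧ Iso 3 (c n)) →
    (∀ n, ∃ m, n ≤ m ∧ (c m).IsBlownUpσ σ 3 ν) →
    ∃ (T : BlowupTower.{u}) (pt : ∀ n, T.X n), IsMaximalOrigin p 3 ν (T.X 0) (pt 0) ∧ IsIsoPointTower 3 ν T pt

/-! ## §4. The D17 laws in σ-form: step projections, the iso → non-iso transition law, no recurrent iso point births -/

/-- [OURS · L1 W4.2] **`f : X_{n+1} ⟶ X_n` is THE BLOW-DOWN of the σ-near step `s → s'`** — σ-copy of res-type-053's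
`StepProjection R N ν s s' f` (`…StrataLineages`): there are step data `(C, P', x')` as in `CanonicalNearStepσ` — a centre `C` and next
cycle state `P'` ALLOWED BY σ from the state of `s`, the closed near point `x' ∈ Bl_C(X_n)(ν)` over `x_n` — with
`s' = (Bl_C(X_n), labels updated, P', x')`, and `f` is `π_C` read on the stage `s'.W`. NOT a statement of the manuscript. [folklore] -/
def StepProjectionσ (σ : Strategy.{u}) (N : ℕ) (ν : ℕ → ℕ) (s s' : MarkedStage.{u}) (f : s'.W ⟶ s.W) : Prop :=
  ∃ (C : s.W.IdealSheafData) (P' : Option (Pending (blowup C))) (h : IsLocallyNoetherian (blowup C))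
    (x' : ↥(blowup C)),
    σ.step s.W s.ln N ν s.L s.P C P' ∧ (blowup.π C).base x' = s.pt ∧
      IsClosed ({x'} : Set ↥(blowup C)) ∧ x' ∈ Scheme.hsStratum (blowup C) N ν ∧
      ∃ e : s' = ⟨blowup C, h, s.L.next (Scheme.hsStratum s.W N ν) C, P', x'⟩,
        f = eqToHom (congrArg MarkedStage.W e) ≫ blowup.π C

/-- [OURS · L1 W4.2] **THE ISO → NON-ISO TRANSITION LAW FOR THE STRATEGY `σ`** — σ-copy of res-type-067's `IsoTransitionLaw3 p Q`
(`…IsoTransitionBirth`; proved for CJS by res-L1-type-o1, `isoTransitionLaw3_holds` p520356): along every σ-chain with `3 ≤ ē` from a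
`Q`-maximal origin of characteristic `p` at level `3`, if `x_n` is isolated in the Hilbert–Samuel locus and `x_{n+1}` is not, the
blow-down of the step carries an iso point birth through `x_{n+1}` (`IsIsoPointBirthAt`, p517090 — strategy-free). σ-SENSITIVE (it speaks
of σ-chains), hence a binder of the σ-closer; expected to hold for every admissible functional σ by the argument of p520356 (the centre
at an isolated stage is the point). NOT a statement of the manuscript. [folklore] -/
def IsoTransitionLaw3σ (σ : Strategy.{u}) (p : ℕ) (Q : ℕ → (ℕ → ℕ) → ∀ X : Scheme.{u}, X → Prop) : Prop :=
  ∀ (ν : ℕ → ℕ) (X : Scheme.{u}) [IsLocallyNoetherian X] (x : X), IsMaximalOrigin p 3 ν X x → Q 3 ν X x →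
  ∀ c : ℕ → MarkedStage.{u}, Reachesσ σ 3 ν (MarkedStage.init X x) (c 0) →
    (∀ n, CanonicalNearStepσ σ 3 ν (c n) (c (n + 1))) → (∀ n, 3 ≤ (c n).geomDirDim) →
    ∀ n, Iso 3 (c n) → ¬ Iso 3 (c (n + 1)) →
      ∃ f : (c (n + 1)).W ⟶ (c n).W, StepProjectionσ σ 3 ν (c n) (c (n + 1)) f ∧
        ∃ Z', IsIsoPointBirthAt 3 ν (c n) (c (n + 1)) f Z'

/-- [OURS · L1 W4.2] **NO RECURRENT ISO POINT BIRTHS FOR THE STRATEGY `σ`** — σ-copy of res-type-067's conjecture-tagged OURS row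
`NoRecurrentIsoPointBirth3 p Q` (p517090): along every MOVING σ-chain with `3 ≤ ē` from a `Q`-maximal origin of characteristic `p` at
level `3`, from some stage on no σ-step carries an iso point birth through the chain point. σ-SENSITIVE (the chains are σ's), hence THE
conjecture-tagged binder of the σ-closer `Sigma.wtopRecIsoMσ_pointed_of_admissible`; OPEN (OURS claim) exactly as the CJS row — what
should decrease across an iso → non-iso → iso excursion is ideation round 8's seed. Refutable by ONE σ-chain with infinitely many
iso → non-iso transitions. NOT a statement of the manuscript. -/
def NoRecurrentIsoPointBirth3σ (σ : Strategy.{u}) (p : ℕ) (Q : ℕ → (ℕ → ℕ) → ∀ X : Scheme.{u}, X → Prop) : Prop :=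
  ∀ (ν : ℕ → ℕ) (X : Scheme.{u}) [IsLocallyNoetherian X] (x : X), IsMaximalOrigin p 3 ν X x → Q 3 ν X x →
  ∀ c : ℕ → MarkedStage.{u}, Reachesσ σ 3 ν (MarkedStage.init X x) (c 0) →
    (∀ n, CanonicalNearStepσ σ 3 ν (c n) (c (n + 1))) → (∀ n, 3 ≤ (c n).geomDirDim) →
    (∀ n, ∃ m, n ≤ m ∧ (c m).IsBlownUpσ σ 3 ν) →
    ∃ n₁, ∀ n, n₁ ≤ n → ∀ f : (c (n + 1)).W ⟶ (c n).W, StepProjectionσ σ 3 ν (c n) (c (n + 1)) f →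
      ∀ Z', ¬ IsIsoPointBirthAt 3 ν (c n) (c (n + 1)) f Z'

/-! ## §5. Transport: at the CJS strategy `σ := Strategy.cjs R` every σ-notion above IS its landed original, definitionally -/

section Transport

variable (R : ∀ S : Scheme.{u}, CentreSeq S → Prop) (N : ℕ) (ν : ℕ → ℕ)

/-- `NoMovingRecurrentNearChainFromσ (σ_CJS R) = NoMovingRecurrentNearChainFrom R`, definitionally. [folklore] -/
theorem noMovingRecurrentNearChainFromσ_cjs_iff (s₀ : MarkedStage.{u}) (G B : MarkedStage.{u} → Prop) :
    NoMovingRecurrentNearChainFromσ (Strategy.cjs R) N ν s₀ G B ↔ NoMovingRecurrentNearChainFrom R N ν s₀ G B :=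
  Iff.rfl

/-- `NoMovingAlternatingNearChainFromσ (σ_CJS R) = NoMovingAlternatingNearChainFrom R`, definitionally. [folklore] -/
theorem noMovingAlternatingNearChainFromσ_cjs_iff (s₀ : MarkedStage.{u}) (G B : MarkedStage.{u} → Prop) :
    NoMovingAlternatingNearChainFromσ (Strategy.cjs R) N ν s₀ G B ↔ NoMovingAlternatingNearChainFrom R N ν s₀ G B :=
  Iff.rfl

/-- `StepProjectionσ (σ_CJS R) = StepProjection R`, definitionally. [folklore] -/
theorem stepProjectionσ_cjs_iff (s s' : MarkedStage.{u}) (f : s'.W ⟶ s.W) :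
    StepProjectionσ (Strategy.cjs R) N ν s s' f ↔ StepProjection R N ν s s' f :=
  Iff.rfl

end Transport

/-- **ROW TRANSPORT (recurrent)**: the landed moving-recurrent row at `Q`-origins IS the σ-row for all CJS strategies `σ_CJS(R)`,
`R` functional admissible — definitionally. [folklore] -/
theorem maxOriginNoMovingRecurrentNearChainAtQ_iff_forall_cjs (p N : ℕ)
    (Q : ℕ → (ℕ → ℕ) → ∀ X : Scheme.{u}, X → Prop) (G B : MarkedStage.{u} → Prop) :
    MaxOriginNoMovingRecurrentNearChainAtQ.{u} p N Q G B ↔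
      ∀ (R : ∀ S : Scheme.{u}, CentreSeq S → Prop), OracleFunctional R → OracleAdmissible R →
        MaxOriginNoMovingRecurrentNearChainAtQσ (Strategy.cjs R) p N Q G B :=
  Iff.rfl

/-- **ROW TRANSPORT (alternating)**. [folklore] -/
theorem maxOriginNoMovingAlternatingNearChainAtQ_iff_forall_cjs (p N : ℕ)
    (Q : ℕ → (ℕ → ℕ) → ∀ X : Scheme.{u}, X → Prop) (G B : MarkedStage.{u} → Prop) :
    MaxOriginNoMovingAlternatingNearChainAtQ.{u} p N Q G B ↔
      ∀ (R : ∀ S : Scheme.{u}, CentreSeq S → Prop), OracleFunctional R → OracleAdmissible R →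
        MaxOriginNoMovingAlternatingNearChainAtQσ (Strategy.cjs R) p N Q G B :=
  Iff.rfl

/-- **ROW TRANSPORT, Ev-Iso**: `WtopEvIsoM p Q ↔ ∀ R functional admissible, WtopEvIsoMσ (σ_CJS R) p Q`, definitionally. [folklore] -/
theorem wtopEvIsoM_iff_forall_cjs (p : ℕ) (Q : ℕ → (ℕ → ℕ) → ∀ X : Scheme.{u}, X → Prop) :
    WtopEvIsoM.{u} p Q ↔
      ∀ (R : ∀ S : Scheme.{u}, CentreSeq S → Prop), OracleFunctional R → OracleAdmissible R →
        WtopEvIsoMσ (Strategy.cjs R) p Q :=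
  Iff.rfl

/-- **ROW TRANSPORT, Rec-NonIso**. [folklore] -/
theorem wtopRecNonIsoM_iff_forall_cjs (p : ℕ) (Q : ℕ → (ℕ → ℕ) → ∀ X : Scheme.{u}, X → Prop) :
    WtopRecNonIsoM.{u} p Q ↔
      ∀ (R : ∀ S : Scheme.{u}, CentreSeq S → Prop), OracleFunctional R → OracleAdmissible R →
        WtopRecNonIsoMσ (Strategy.cjs R) p Q :=
  Iff.rfl

/-- **ROW TRANSPORT, Rec-Iso** — so the v8.2 registered pointed stub `WtopRecIsoM p QPointed` reads
`∀ R functional admissible, WtopRecIsoMσ (σ_CJS R) p QPointed`. [folklore] -/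
theorem wtopRecIsoM_iff_forall_cjs (p : ℕ) (Q : ℕ → (ℕ → ℕ) → ∀ X : Scheme.{u}, X → Prop) :
    WtopRecIsoM.{u} p Q ↔
      ∀ (R : ∀ S : Scheme.{u}, CentreSeq S → Prop), OracleFunctional R → OracleAdmissible R →
        WtopRecIsoMσ (Strategy.cjs R) p Q :=
  Iff.rfl

/-- **ROW TRANSPORT, ALT**. [folklore] -/
theorem wtopAltM_iff_forall_cjs (p : ℕ) (Q : ℕ → (ℕ → ℕ) → ∀ X : Scheme.{u}, X → Prop) :
    WtopAltM.{u} p Q ↔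
      ∀ (R : ∀ S : Scheme.{u}, CentreSeq S → Prop), OracleFunctional R → OracleAdmissible R →
        WtopAltMσ (Strategy.cjs R) p Q :=
  Iff.rfl

/-- **ROW TRANSPORT, extraction**: D7's `IsoTailTowerExtractionM p ↔ ∀ R functional admissible, IsoTailTowerExtractionMσ (σ_CJS R) p`.
[folklore] -/
theorem isoTailTowerExtractionM_iff_forall_cjs (p : ℕ) :
    IsoTailTowerExtractionM.{u} p ↔
      ∀ (R : ∀ S : Scheme.{u}, CentreSeq S → Prop), OracleFunctional R → OracleAdmissible R →
        IsoTailTowerExtractionMσ (Strategy.cjs R) p :=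
  Iff.rfl

/-- **ROW TRANSPORT, transition law**: `IsoTransitionLaw3 p Q ↔ ∀ R functional admissible, IsoTransitionLaw3σ (σ_CJS R) p Q`. [folklore] -/
theorem isoTransitionLaw3_iff_forall_cjs (p : ℕ) (Q : ℕ → (ℕ → ℕ) → ∀ X : Scheme.{u}, X → Prop) :
    IsoTransitionLaw3.{u} p Q ↔
      ∀ (R : ∀ S : Scheme.{u}, CentreSeq S → Prop), OracleFunctional R → OracleAdmissible R →
        IsoTransitionLaw3σ (Strategy.cjs R) p Q :=
  Iff.rfl

/-- **ROW TRANSPORT, birth law**: `NoRecurrentIsoPointBirth3 p Q ↔ ∀ R functional admissible, NoRecurrentIsoPointBirth3σ (σ_CJS R) p Q`.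
[folklore] -/
theorem noRecurrentIsoPointBirth3_iff_forall_cjs (p : ℕ) (Q : ℕ → (ℕ → ℕ) → ∀ X : Scheme.{u}, X → Prop) :
    NoRecurrentIsoPointBirth3.{u} p Q ↔
      ∀ (R : ∀ S : Scheme.{u}, CentreSeq S → Prop), OracleFunctional R → OracleAdmissible R →
        NoRecurrentIsoPointBirth3σ (Strategy.cjs R) p Q :=
  Iff.rfl

end Summit.ResolutionOfSingularities.ResolutionOfSingularities.Theorems.SigmaMaxModificationsCorridor3.Sigma

end
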